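import Summits.BirchSwinnertonDyer.BirchSwinnertonDyer.Theorems.KolyvaginDepthDoorMSymbolCert1717b1Cert
import HarnessLib

/-!
# Route `KolyvaginDepthDoor`, crux `KolyvaginDepthSupplyKN` (stmt-BirchSwinnertonDyer-22820) —
# DEPTH TABLE v30, DATA of `1717b1`, part 2 (Inv1) of the check of `cert1717b1`

Helper file of the lead prover of line `levelone` (kdd-p1 g35; `--supports stmt-BirchSwinnertonDyer-22820 --as helper`);
MACHINE-WRITTEN DATA + `decide` (generator `work/py/genq_lean.py`, kit 1′ `…MSymbolCertCosetsC`). One quarter of part 2 of the check of `…MSymbolCert1717b1` (core rows reduce to the core matrix / the inverse certificate mod 65521), split for the elaboration budget. It closes nothing and BSD is NOT proved by it.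

References: [CremonaAlgorithms1997] §2.2–2.5, §2.8, Table 1 (1717b1); [PopaZagier2017] §4 (13); [Kim2022StructureSelmer] §1.4.3;
[MazurTateTeitelbaum1986Invent] §I.8.
-/

set_option linter.dupNamespace false
-- the packed numerals are long literals
set_option linter.style.longLine false

noncomputable section

open scoped MatrixGroups ModularForm
open CongruenceSubgroup
open Literature.NumberTheory.EllipticCurves Literature.NumberTheory.EllipticCurves.ModularForms
open Literature.NumberTheory.Automorphic.PopaZagier (coeff12 coeff12M coeff coeffN)
open Summit.BirchSwinnertonDyer.BirchSwinnertonDyer.Rank2Observatory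
open Summit.BirchSwinnertonDyer.BirchSwinnertonDyer.Rank1Residual (IntModel.frobeniusTrace_eq IntModel.minimalDiscriminantInt_eq)
open Summit.BirchSwinnertonDyer.BirchSwinnertonDyer.Theorems.KolyvaginDepthDoor.MSymbolCert.Cert389a1
  (H3 H3fin support_subset_H3fin H3fin_det H3mat_nodup H3_det H3_coeff eval_map eval_append)

namespace Summit.BirchSwinnertonDyer.BirchSwinnertonDyer.Theorems.KolyvaginDepthDoor.MSymbolCert.Cert1717b1

/-! ## §1 Part 2 of the check: Inv1 -/

set_option maxHeartbeats 4000000 in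
set_option maxRecDepth 8192 in
/-- **Certificate part 2 (inv rows `20 ≤ r < 40`)** of `cert1717b1` (chunked kernel checks; 8 files at `m − 1 = 157`). [folklore] -/
theorem cert1717b1_invRows1 : ∀ r, 20 ≤ r → r < 40 → cert1717b1.invRow r = true := by
  have h0 : (List.range' 20 10).all (fun r => cert1717b1.invRow r) = true := by decide +kernel
  have h1 : (List.range' 30 10).all (fun r => cert1717b1.invRow r) = true := by decide +kernel
  intro r _hr1 hr2
  by_cases c : r < 30
  · exact cert1717b1.invRow_chunk h0 r (by omega) (by omega)
  exact cert1717b1.invRow_chunk h1 r (by omega) (by omega)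

end Summit.BirchSwinnertonDyer.BirchSwinnertonDyer.Theorems.KolyvaginDepthDoor.MSymbolCert.Cert1717b1

end
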